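import Literature.IUT.LogVolume.PacketMonomialBox
import Literature.IUT.LogVolume.DyadicPrimeResidueIsometryStable
import HarnessLib

/-!
# Box depth of `(R_I)^∼`: a lattice criterion for factorwise-isometry stability of MIXED tensor packets
# (depth `0` at any slot, depth `1` at a slot with residue field `𝔽₂`)

Classical local algebra (nothing disputed; the [IUTchIV] locator records where the abc-iut cell uses it).  [IUTchIV] Prop. 1.1 p. 9
attaches to a packet `V = ⊗_{ℚ_p} k_i` over an ARBITRARY finite family of `p`-adic fields the maximal `ℤ_p`-order `(R_I)^∼` (the tree's
`normalizedPacket`).  abc-iut-E-t58's `PacketMonomialBox` attaches to slot bases `b^{(i)}` the MONOMIAL BOX `{z : ‖z_J‖·∏_i ‖b^{(i)}_{J_i}‖ ≤ 1}`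
(spelled out in every statement — no definition is introduced; for norm-DOMINATED bases it is the `ℤ_p`-span of the integral pure tensors,
abc-iut-E-t9's (PG)-span), proves `Box ⊆ (R_I)^∼` (`MonomialBox.mem_normalizedPacket_of_box`) and that `Box` is mapped into itself by every
factorwise CONTRACTION (`MonomialBox.box_map_of_dominated`).  THIS FILE turns the BOX DEPTH of `(R_I)^∼` into stability statements:

* §1 `norm_mul_prod_norm_le_one_of_smul_purePacket_mem` — the converse of E-t58's §1: an integral monomial `c·⊗x_i ∈ (R_I)^∼` has
  `‖c‖·∏‖x_i‖ ≤ 1` (evaluate at `⊗σ_i : V → ℚ̄_p`, embeddings are isometries, integral elements of `ℚ̄_p` have norm `≤ 1`); so for dominated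
  bases «monomial in `(R_I)^∼`» ⟺ «monomial in Box».
* §2 DEPTH 0 (`congr_image_normalizedPacket_eq_of_subset_box`) — if `(R_I)^∼ ⊆ Box` then EVERY tuple of factorwise `ℚ_p`-linear isometries
  maps `(R_I)^∼` onto itself (any slots; E-t9's «(PG) ⟹ stable» in box currency).
* §3 DEPTH 1 AT A SLOT WITH RESIDUE FIELD `𝔽₂` (`congr_image_normalizedPacket_eq_of_mul_pi_box`) — let slot `i₀` have all units `≡ 1`
  (`‖w‖ = 1 → ‖w − 1‖ < 1`: `p = 2`, `f = 1`) and let `π` dominate the open unit ball (`‖y‖ < 1 → ‖y‖ ≤ ‖π‖`); the OTHER slot fields are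
  ARBITRARY.  If `(π ⊗ 1 ⊗ ⋯ ⊗ 1)·(R_I)^∼ ⊆ Box` (one `π`-step of slack in the `i₀`-direction), then every `ℚ_p`-linear isometry `g` at slot
  `i₀` (identity at the other slots) maps `(R_I)^∼` onto itself.  Mechanism: by abc-iut-E-t47's strictness
  `DyadicPrimeResidue.norm_sub_lt_of_isometry` one has `‖g x − x‖ ≤ ‖π‖·‖x‖` (`norm_sub_le_of_isometry`), so `g − 1 = T′ ∘ (π·)` with `T′`
  norm-non-increasing; `(g ⊗ 1) z = z + (T′ ⊗ 1)((π ⊗ 1) z)` (`PiTensorProduct.map_update_add`, `map_comp`), and `(T′ ⊗ 1)` maps Box into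
  Box ⊆ `(R_I)^∼`.

Use (abc-iut cell, R-J row Y-29b, rows R-20 / R-26 of E ROWS): §3 is the lattice face of the «p = 2 mixed-packet criterion» — it CERTIFIES
the stability of the mixed dyadic packets that are fixed although a slot field is a two-slot mover (abc-iut-E-t7's exact table: e.g.
`ℚ₂(√2) ⊗ ℚ₂(√−2)`, whose `(R_I)^∼` has index `2` over Box but `π·(R_I)^∼ ⊆ Box` at both slots) and the residual dyadic class
(`ℚ₂(√−1) ⊗ ℚ₂(√−1)`: index `2` over Box — abc-iut-E-t9's `IsometryStablePureTensorCriterionDyadic` — absorbed by the `π`-step).  Companion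
statements: the OPERATOR face (abc-iut-E-t20, «isometry-stable ⟺ strict-contraction-stable» at such slots) and the AMPLE face (abc-iut-E-t9,
«stable ⟺ purely generated» at slots with `p` odd or `f ≥ 2`).  Statement about CONTAINERS only; it takes no side on [IUTchIII] Cor. 3.12.
PROOF-ONLY file (theorems, no definitions, no `Prop` facts, no `sorry`).
[cite: Mochizuki2012, IUTchIV Prop. 1.1 p. 9] [cite: WeilBNT1967, Ch. II §1, Prop. 3] [cite: SerreLocalFields1979, Ch. III §3, Prop. 7]
[cite: NeukirchANT1999, Ch. II (4.8)]
-/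

noncomputable section

open Module Function

namespace Literature.IUT.LogVolume

namespace BoxDepth

/-! ## §0 One field: at a slot with residue field `𝔽₂` every isometry moves each element by at most a `π`-multiple of its norm -/

section OneField

variable {p : ℕ} [Fact p.Prime] {K : Type} [NontriviallyNormedField K] [NormedAlgebra ℚ_[p] K]

/-- A dominator `π` of the open unit ball (`‖y‖ < 1 → ‖y‖ ≤ ‖π‖`) is non-zero: a non-trivially normed field has non-zero elements of norm
`< 1`. [cite: NeukirchANT1999, Ch. II (4.8)] -/
theorem ne_zero_of_dominates (π : K) (hπmax : ∀ y : K, ‖y‖ < 1 → ‖y‖ ≤ ‖π‖) : π ≠ 0 := by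
  obtain ⟨y, hy0, hy1⟩ := NormedField.exists_norm_lt_one K
  intro h
  have := hπmax y hy1
  rw [h, norm_zero] at this
  exact absurd (lt_of_lt_of_le hy0 this) (lt_irrefl _)

/-- **`‖g x − x‖ ≤ ‖π‖·‖x‖`** for every `ℚ_p`-linear isometry `g` of a field whose units are all `≡ 1` (residue field `𝔽₂`), `π` dominating
the open unit ball: abc-iut-E-t47's strictness `‖g x − x‖ < ‖x‖` (`DyadicPrimeResidue.norm_sub_lt_of_isometry`) read through the value group
(`(g x − x)·x⁻¹` has norm `< 1`, hence `≤ ‖π‖`). [cite: SerreLocalFields1979, Ch. III §3, Prop. 7] -/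
theorem norm_sub_le_of_isometry (hres : ∀ w : K, ‖w‖ = 1 → ‖w - 1‖ < 1) (π : K)
    (hπmax : ∀ y : K, ‖y‖ < 1 → ‖y‖ ≤ ‖π‖) (g : K ≃ₗ[ℚ_[p]] K) (hg : ∀ x, ‖g x‖ = ‖x‖) (x : K) :
    ‖g x - x‖ ≤ ‖π‖ * ‖x‖ := by
  by_cases hx : x = 0
  · subst hx; simp
  have hlt := DyadicPrimeResidue.norm_sub_lt_of_isometry hres g hg hx
  have hxpos : 0 < ‖x‖ := norm_pos_iff.mpr hx
  have hw : ‖(g x - x) * x⁻¹‖ < 1 := by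
    rw [norm_mul, norm_inv, ← div_eq_mul_inv, div_lt_one hxpos]
    exact hlt
  have hle := hπmax _ hw
  rw [norm_mul, norm_inv, ← div_eq_mul_inv, div_le_iff₀ hxpos] at hle
  exact hle

/-- **The contraction `T′ := (g − 1) ∘ (π⁻¹·)` is norm-non-increasing** (`‖T′ y‖ = ‖g(π⁻¹y) − π⁻¹y‖ ≤ ‖π‖·‖π⁻¹y‖ = ‖y‖`), so that
`g − 1 = T′ ∘ (π·)` exhibits every isometry at a residue-field-`𝔽₂` slot as `1 + (contraction) ∘ (π·)`.
[cite: SerreLocalFields1979, Ch. III §3, Prop. 7] -/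
theorem norm_contraction_le (hres : ∀ w : K, ‖w‖ = 1 → ‖w - 1‖ < 1) (π : K)
    (hπmax : ∀ y : K, ‖y‖ < 1 → ‖y‖ ≤ ‖π‖) (g : K ≃ₗ[ℚ_[p]] K) (hg : ∀ x, ‖g x‖ = ‖x‖) (y : K) :
    ‖(((g : K →ₗ[ℚ_[p]] K) - LinearMap.id) ∘ₗ LinearMap.mulLeft ℚ_[p] π⁻¹) y‖ ≤ ‖y‖ := by
  have hπ : π ≠ 0 := ne_zero_of_dominates π hπmax
  have h := norm_sub_le_of_isometry hres π hπmax g hg (π⁻¹ * y)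
  rw [norm_mul, norm_inv, ← mul_assoc, mul_inv_cancel₀ (norm_ne_zero_iff.mpr hπ), one_mul] at h
  simpa [LinearMap.comp_apply, LinearMap.mulLeft_apply, LinearMap.sub_apply] using h

end OneField

/-! ## §1 Integral monomials have box coordinates (the converse of `MonomialBox.smul_purePacket_mem_normalizedPacket`) -/

section Packet

variable (p : ℕ) [hp : Fact p.Prime] {I : Type} [Fintype I] [DecidableEq I]
  (k : I → Type) [∀ i, NontriviallyNormedField (k i)] [∀ i, NormedAlgebra ℚ_[p] (k i)]
  [∀ i, IsUltrametricDist (k i)] [∀ i, ProperSpace (k i)]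

omit [DecidableEq I] in
/-- **`c·⊗x_i ∈ (R_I)^∼ ⟹ ‖c‖·∏_i ‖x_i‖ ≤ 1`** (any slot fields): evaluate at `Φ = ⊗σ_i : V → ℚ̄_p` for embeddings `σ_i : k_i → ℚ̄_p`
(campaign `exists_algHom_of_algHom`); `Φ(c·⊗x_i) = c·∏σ_i(x_i)` is `ℤ_p`-integral, hence of norm `≤ 1`, and has norm `‖c‖·∏‖x_i‖`
(`norm_map_algHom`).  With E-t58's §1 this makes «monomial in `(R_I)^∼`» and «monomial in Box» equivalent for dominated bases — the box is
the (PG)-span. [cite: Mochizuki2012, IUTchIV Prop. 1.1 p. 9] [cite: NeukirchANT1999, Ch. II (4.8)] -/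
theorem norm_mul_prod_norm_le_one_of_smul_purePacket_mem [Nonempty I] (c : ℚ_[p]) (x : Π i, k i)
    (h : c • purePacket p k x ∈ normalizedPacket p k) : ‖c‖ * ∏ i, ‖x i‖ ≤ 1 := by
  classical
  have σ : ∀ i, k i →ₐ[ℚ_[p]] PadicAlgCl p := fun i => Classical.choice EmbeddingOrder.nonempty_algHom_padicAlgCl
  obtain ⟨Φ, hΦ⟩ := exists_algHom_of_algHom p k σ
  have hint : ‖Φ (c • purePacket p k x)‖ ≤ 1 :=
    (Literature.NumberTheory.GaloisRepresentations.PadicAlgCl.norm_le_one_iff_isIntegral _).mpr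
      ((isIntegral_of_mem_normalizedPacket p k h).map (Φ.restrictScalars ℤ_[p]))
  have hprod : ∏ i, ‖σ i (x i)‖ = ∏ i, ‖x i‖ := Finset.prod_congr rfl fun i _ => norm_map_algHom (σ i) _
  rw [map_smul, hΦ, norm_smul, norm_prod, hprod] at hint
  exact hint

variable {κ : I → Type} [∀ i, Fintype (κ i)] (b : ∀ i, Basis (κ i) ℚ_[p] (k i))

omit [DecidableEq I] [∀ i, Fintype (κ i)] in
/-- **Box coordinates of a monomial in `(R_I)^∼`**: if `c·⊗_i b^{(i)}_{J_i} ∈ (R_I)^∼` then `‖c‖·∏_i ‖b^{(i)}_{J_i}‖ ≤ 1`.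
[cite: Mochizuki2012, IUTchIV Prop. 1.1 p. 9] -/
theorem norm_mul_prod_norm_le_one_of_monomial_mem [Nonempty I] (c : ℚ_[p]) (J : Π i, κ i)
    (h : c • purePacket p k (fun i => b i (J i)) ∈ normalizedPacket p k) : ‖c‖ * ∏ i, ‖b i (J i)‖ ≤ 1 :=
  norm_mul_prod_norm_le_one_of_smul_purePacket_mem p k c (fun i => b i (J i)) h

/-! ## §2 Depth `0`: `(R_I)^∼ ⊆ Box` ⟹ stable under every factorwise isometry tuple -/

/-- **DEPTH 0.**  If the slot bases are norm-dominated and `(R_I)^∼ ⊆ Box` (every `z ∈ (R_I)^∼` has `‖z_J‖·∏_i‖b^{(i)}_{J_i}‖ ≤ 1` for all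
`J` — equivalently, with E-t58's §1, `(R_I)^∼ = Box`), then EVERY tuple of factorwise `ℚ_p`-linear isometries maps `(R_I)^∼` onto itself:
`(⊗g_i)((R_I)^∼) ⊆ (⊗g_i)(Box) ⊆ Box ⊆ (R_I)^∼` and the same for the inverses.  Any slot fields.
[cite: Mochizuki2012, IUTchIV Prop. 1.1 p. 9] [cite: WeilBNT1967, Ch. II §1, Prop. 3] -/
theorem congr_image_normalizedPacket_eq_of_subset_box [Nonempty I]
    (hdom : ∀ i (x : k i) (m : κ i), ‖(b i).repr x m • b i m‖ ≤ ‖x‖)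
    (hR : ∀ z ∈ normalizedPacket p k, ∀ J : Π i, κ i, ‖(Basis.piTensorProduct b).repr z J‖ * ∏ i, ‖b i (J i)‖ ≤ 1)
    (g : ∀ i, k i ≃ₗ[ℚ_[p]] k i) (hg : ∀ i x, ‖g i x‖ = ‖x‖) :
    (PiTensorProduct.congr g : PacketAlgebra p k ≃ₗ[ℚ_[p]] PacketAlgebra p k) ''
        (normalizedPacket p k : Set (PacketAlgebra p k)) = normalizedPacket p k := by
  have hg' : ∀ i x, ‖(g i).symm x‖ ≤ ‖x‖ := fun i x => by
    conv_rhs => rw [← (g i).apply_symm_apply x, hg i]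
  have h1 : ∀ z, (PiTensorProduct.congr g : PacketAlgebra p k ≃ₗ[ℚ_[p]] PacketAlgebra p k) z =
      PiTensorProduct.map (fun i => (g i : k i →ₗ[ℚ_[p]] k i)) z := fun z => rfl
  have h2 : ∀ z, (PiTensorProduct.congr g : PacketAlgebra p k ≃ₗ[ℚ_[p]] PacketAlgebra p k).symm z =
      PiTensorProduct.map (fun i => ((g i).symm : k i →ₗ[ℚ_[p]] k i)) z := fun z => rfl
  apply Set.Subset.antisymm
  · rintro _ ⟨z, hz, rfl⟩
    rw [h1]
    exact MonomialBox.mem_normalizedPacket_of_box p k b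
      (MonomialBox.box_map_of_dominated p k b hdom _ (fun i x => (hg i x).le) (hR z hz))
  · intro z hz
    refine ⟨(PiTensorProduct.congr g : PacketAlgebra p k ≃ₗ[ℚ_[p]] PacketAlgebra p k).symm z, ?_,
      LinearEquiv.apply_symm_apply _ _⟩
    rw [h2]
    exact MonomialBox.mem_normalizedPacket_of_box p k b (MonomialBox.box_map_of_dominated p k b hdom _ hg' (hR z hz))

/-! ## §3 Depth `1` at a slot with residue field `𝔽₂`: `(π ⊗ 1)·(R_I)^∼ ⊆ Box` ⟹ stable under the isometries of that slot -/

/-- **One isometry at slot `i₀`, written as `1 + T′ ∘ (π·)`, maps `(R_I)^∼` INTO `(R_I)^∼` when `(π ⊗ 1)·(R_I)^∼ ⊆ Box.**  Hypotheses: slot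
`i₀` has all units `≡ 1` and `π` dominates its open unit ball; the slot bases are norm-dominated; for every `z ∈ (R_I)^∼` the element
`(π at slot i₀, identity elsewhere) z` has box coordinates; `g_i` is a `ℚ_p`-linear isometry at `i₀` and the identity at every other slot.
Then `(⊗g_i) z = z + (⊗T′_i)((⊗π_i) z) ∈ (R_I)^∼` (`T′_{i₀} = (g_{i₀} − 1)∘(π⁻¹·)` is norm-non-increasing by `norm_contraction_le`, the other
`T′_i = 1`; `PiTensorProduct.map_update_add` / `map_comp`; E-t58's `box_map_of_dominated` and `mem_normalizedPacket_of_box`).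
[cite: Mochizuki2012, IUTchIV Prop. 1.1 p. 9] [cite: SerreLocalFields1979, Ch. III §3, Prop. 7] [cite: WeilBNT1967, Ch. II §1, Prop. 3] -/
theorem map_mem_normalizedPacket_of_mul_pi_box [Nonempty I]
    (hdom : ∀ i (x : k i) (m : κ i), ‖(b i).repr x m • b i m‖ ≤ ‖x‖) (i₀ : I)
    (hres : ∀ w : k i₀, ‖w‖ = 1 → ‖w - 1‖ < 1) (π : k i₀) (hπmax : ∀ y : k i₀, ‖y‖ < 1 → ‖y‖ ≤ ‖π‖)
    (hπR : ∀ z ∈ normalizedPacket p k, ∀ J : Π i, κ i,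
      ‖(Basis.piTensorProduct b).repr (PiTensorProduct.map
          (update (fun i => (LinearMap.id : k i →ₗ[ℚ_[p]] k i)) i₀ (LinearMap.mulLeft ℚ_[p] π)) z) J‖ *
        ∏ i, ‖b i (J i)‖ ≤ 1)
    (g : ∀ i, k i ≃ₗ[ℚ_[p]] k i) (hg : ∀ x, ‖g i₀ x‖ = ‖x‖) (hoff : ∀ i, i ≠ i₀ → g i = LinearEquiv.refl ℚ_[p] (k i))
    {z : PacketAlgebra p k} (hz : z ∈ normalizedPacket p k) :
    PiTensorProduct.map (fun i => (g i : k i →ₗ[ℚ_[p]] k i)) z ∈ normalizedPacket p k := by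
  classical
  have hπ : π ≠ 0 := ne_zero_of_dominates π hπmax
  -- the slot maps: `u = (g_i)`, `N = g_{i₀} − 1 = T′ ∘ (π·)`
  set u : ∀ i, k i →ₗ[ℚ_[p]] k i := fun i => (g i : k i →ₗ[ℚ_[p]] k i) with hu
  set N : k i₀ →ₗ[ℚ_[p]] k i₀ := (g i₀ : k i₀ →ₗ[ℚ_[p]] k i₀) - LinearMap.id with hN
  set T' : k i₀ →ₗ[ℚ_[p]] k i₀ := N ∘ₗ LinearMap.mulLeft ℚ_[p] π⁻¹ with hT'
  set Lπ : k i₀ →ₗ[ℚ_[p]] k i₀ := LinearMap.mulLeft ℚ_[p] π with hLπ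
  have hT'n : ∀ y, ‖T' y‖ ≤ ‖y‖ := fun y => norm_contraction_le hres π hπmax (g i₀) hg y
  -- `u = update u i₀ (id + N)`
  have hsplit : u = update u i₀ (LinearMap.id + N) := by
    rw [hN, add_sub_cancel]
    exact (update_eq_self i₀ u).symm
  -- `update u i₀ id = (fun i => id)`
  have hid : update u i₀ LinearMap.id = fun i => (LinearMap.id : k i →ₗ[ℚ_[p]] k i) := by
    funext i
    by_cases hi : i = i₀
    · subst hi; rw [update_self]
    · rw [update_of_ne hi, hu]
      change ((g i : k i →ₗ[ℚ_[p]] k i)) = LinearMap.id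
      rw [hoff i hi]; rfl
  -- `update u i₀ N = (update 1 i₀ T′) ∘ (update 1 i₀ Lπ)` slotwise
  have hcomp : update u i₀ N = fun i =>
      (update (fun i => (LinearMap.id : k i →ₗ[ℚ_[p]] k i)) i₀ T' i) ∘ₗ
        (update (fun i => (LinearMap.id : k i →ₗ[ℚ_[p]] k i)) i₀ Lπ i) := by
    funext i
    by_cases hi : i = i₀
    · subst hi
      rw [update_self, update_self, update_self]
      ext x
      simp only [hT', hLπ, LinearMap.comp_apply, LinearMap.mulLeft_apply]
      rw [← mul_assoc, inv_mul_cancel₀ hπ, one_mul]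
    · rw [update_of_ne hi, update_of_ne hi, update_of_ne hi, hu, LinearMap.id_comp]
      change ((g i : k i →ₗ[ℚ_[p]] k i)) = LinearMap.id
      rw [hoff i hi]; rfl
  -- decompose `(⊗g_i) z`
  have hdec : PiTensorProduct.map u z = z +
      PiTensorProduct.map (update (fun i => (LinearMap.id : k i →ₗ[ℚ_[p]] k i)) i₀ T')
        (PiTensorProduct.map (update (fun i => (LinearMap.id : k i →ₗ[ℚ_[p]] k i)) i₀ Lπ) z) := by
    conv_lhs => rw [hsplit]
    rw [PiTensorProduct.map_update_add, LinearMap.add_apply, hid, PiTensorProduct.map_id, LinearMap.id_apply, hcomp,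
      PiTensorProduct.map_comp, LinearMap.comp_apply]
  rw [hdec]
  refine Subring.add_mem _ hz (MonomialBox.mem_normalizedPacket_of_box p k b ?_)
  refine MonomialBox.box_map_of_dominated p k b hdom _ (fun i x => ?_) (hπR z hz)
  by_cases hi : i = i₀
  · subst hi; rw [update_self]; exact hT'n x
  · rw [update_of_ne hi]; exact le_rfl

/-- **DEPTH 1 AT A RESIDUE-FIELD-`𝔽₂` SLOT.**  Under the hypotheses of `map_mem_normalizedPacket_of_mul_pi_box` — slot `i₀` with all units
`≡ 1` (`p = 2`, `f = 1`), `π` dominating its open unit ball, norm-dominated slot bases, and ONE LATTICE CONTAINMENT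
`(π ⊗ 1 ⊗ ⋯ ⊗ 1)·(R_I)^∼ ⊆ Box` — every `ℚ_p`-linear ISOMETRY at slot `i₀` (identity at the other slots, whose fields are ARBITRARY) maps
`(R_I)^∼` ONTO itself.  This is the lattice form of the `p = 2` mixed-packet phenomenon: `(R_I)^∼` may exceed the box (the (PG)-span) by
ONE `π`-step in the `i₀`-direction without being moved by the isometries of slot `i₀`.
[cite: Mochizuki2012, IUTchIV Prop. 1.1 p. 9] [cite: SerreLocalFields1979, Ch. III §3, Prop. 7] [cite: WeilBNT1967, Ch. II §1, Prop. 3] -/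
theorem congr_image_normalizedPacket_eq_of_mul_pi_box [Nonempty I]
    (hdom : ∀ i (x : k i) (m : κ i), ‖(b i).repr x m • b i m‖ ≤ ‖x‖) (i₀ : I)
    (hres : ∀ w : k i₀, ‖w‖ = 1 → ‖w - 1‖ < 1) (π : k i₀) (hπmax : ∀ y : k i₀, ‖y‖ < 1 → ‖y‖ ≤ ‖π‖)
    (hπR : ∀ z ∈ normalizedPacket p k, ∀ J : Π i, κ i,
      ‖(Basis.piTensorProduct b).repr (PiTensorProduct.map
          (update (fun i => (LinearMap.id : k i →ₗ[ℚ_[p]] k i)) i₀ (LinearMap.mulLeft ℚ_[p] π)) z) J‖ *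
        ∏ i, ‖b i (J i)‖ ≤ 1)
    (g : ∀ i, k i ≃ₗ[ℚ_[p]] k i) (hg : ∀ x, ‖g i₀ x‖ = ‖x‖) (hoff : ∀ i, i ≠ i₀ → g i = LinearEquiv.refl ℚ_[p] (k i)) :
    (PiTensorProduct.congr g : PacketAlgebra p k ≃ₗ[ℚ_[p]] PacketAlgebra p k) ''
        (normalizedPacket p k : Set (PacketAlgebra p k)) = normalizedPacket p k := by
  have hg' : ∀ x, ‖(g i₀).symm x‖ = ‖x‖ := fun x => by
    conv_rhs => rw [← (g i₀).apply_symm_apply x, hg]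
  have hoff' : ∀ i, i ≠ i₀ → (g i).symm = LinearEquiv.refl ℚ_[p] (k i) := fun i hi => by
    rw [hoff i hi]; rfl
  have h1 : ∀ z, (PiTensorProduct.congr g : PacketAlgebra p k ≃ₗ[ℚ_[p]] PacketAlgebra p k) z =
      PiTensorProduct.map (fun i => (g i : k i →ₗ[ℚ_[p]] k i)) z := fun z => rfl
  have h2 : ∀ z, (PiTensorProduct.congr g : PacketAlgebra p k ≃ₗ[ℚ_[p]] PacketAlgebra p k).symm z =
      PiTensorProduct.map (fun i => ((g i).symm : k i →ₗ[ℚ_[p]] k i)) z := fun z => rfl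
  apply Set.Subset.antisymm
  · rintro _ ⟨z, hz, rfl⟩
    rw [h1]
    exact map_mem_normalizedPacket_of_mul_pi_box p k b hdom i₀ hres π hπmax hπR g hg hoff hz
  · intro z hz
    refine ⟨(PiTensorProduct.congr g : PacketAlgebra p k ≃ₗ[ℚ_[p]] PacketAlgebra p k).symm z, ?_,
      LinearEquiv.apply_symm_apply _ _⟩
    rw [h2]
    exact map_mem_normalizedPacket_of_mul_pi_box p k b hdom i₀ hres π hπmax hπR (fun i => (g i).symm) hg' hoff' hz

/-- **… hence no `z ∈ (R_I)^∼` is moved out of `(R_I)^∼` by an isometry of slot `i₀`** under the depth-1 containment — the mixed dyadic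
packets of the abc-iut exact table that are FIXED although slot `i₀`'s field is a two-slot mover are exactly of this kind.
[cite: Mochizuki2012, IUTchIV Prop. 1.1 p. 9] -/
theorem not_exists_mover_of_mul_pi_box [Nonempty I]
    (hdom : ∀ i (x : k i) (m : κ i), ‖(b i).repr x m • b i m‖ ≤ ‖x‖) (i₀ : I)
    (hres : ∀ w : k i₀, ‖w‖ = 1 → ‖w - 1‖ < 1) (π : k i₀) (hπmax : ∀ y : k i₀, ‖y‖ < 1 → ‖y‖ ≤ ‖π‖)
    (hπR : ∀ z ∈ normalizedPacket p k, ∀ J : Π i, κ i,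
      ‖(Basis.piTensorProduct b).repr (PiTensorProduct.map
          (update (fun i => (LinearMap.id : k i →ₗ[ℚ_[p]] k i)) i₀ (LinearMap.mulLeft ℚ_[p] π)) z) J‖ *
        ∏ i, ‖b i (J i)‖ ≤ 1) :
    ¬ ∃ (g : ∀ i, k i ≃ₗ[ℚ_[p]] k i) (_ : ∀ x, ‖g i₀ x‖ = ‖x‖) (_ : ∀ i, i ≠ i₀ → g i = LinearEquiv.refl ℚ_[p] (k i))
        (z : PacketAlgebra p k), z ∈ normalizedPacket p k ∧
          (PiTensorProduct.congr g : PacketAlgebra p k ≃ₗ[ℚ_[p]] PacketAlgebra p k) z ∉ normalizedPacket p k := by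
  rintro ⟨g, hg, hoff, z, hz, hmv⟩
  exact hmv (map_mem_normalizedPacket_of_mul_pi_box p k b hdom i₀ hres π hπmax hπR g hg hoff hz)

end Packet

end BoxDepth

end Literature.IUT.LogVolume

end
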